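import Literature.NumberTheory.Automorphic.ResGLnKugaCuspidal
import HarnessLib

/-!
# The Hermitian pairing of the adjoint argument — crux HeckeEigenvalueField (stmt-Langlands-13632),
# line Sketch, stub `stub_end_pairing`

Statement.  Let `π` be a clean cuspidal automorphic representation datum of `GL_n(𝔸_K)` with a unitary
twist `T` and an automorphic measure `μA`, and let `⟨ , ⟩ = carrierForm π λ (pet)` be the tree's positive
definite Hermitian form on `W ⊗ E_λ` (the unitarily normalised Petersson product of
`CuspidalPeterssonForm` tensored with the admissible form of `E_λ`, conjugate-linear in the FIRST slot,
`ResGLnKugaData`).  Then `⟨w, ·⟩` is additive and `ℂ`-linear, `⟨w, v⟩ = conj ⟨v, w⟩`, `0 < re ⟨v, v⟩`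
for `v ≠ 0`, and along the orthonormal basis `xD` of `𝔭₀` the Leibniz action
`X·(w ⊗ e) = Xw ⊗ e + w ⊗ dE(X)e` has the flipped adjoint `-(π(X) ⊗ 1 - 1 ⊗ dE(X))`:
`⟨v, X·u⟩ = ⟨-(π(X) ⊗ 1 - 1 ⊗ dE(X)) v, u⟩`.

Proof.  The first four items are the axioms of `Kuga.IsPosForm` for `carrierForm`
(`ConeDictionary.isPosForm_carrierForm` over `UnitaryTwist.isPosForm_pet`) and their derived second-slot
versions (`Kuga.IsPosForm.add_right/smul_right/eq_zero_of_re_self_eq_zero`).  For the last one, the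
`xD i` are Hermitian (`ConeDictionary.conjTranspose_xD`) of norm exponent zero
(`ResGLnCartan.mixedTrace_trace_x`), so the Petersson product is skew along them
(`UnitaryTwist.pet_lieDerivW_left`) and the tree's adjunction `ConeDictionary.carrierForm_lie_left`
gives `⟨X·u, v⟩ = -⟨u, s v⟩`, `s = π(X) ⊗ 1 - 1 ⊗ dE(X)`; conjugating twice (`conj_symm`) and moving the
sign into the first slot (`neg_left`) yields the claim.
[cite: BorelWallach2000, II §2.2 (4)–(5) and §2.5] [cite: Borel1997, 11.12 (2)]

Theorems only (no definitions, no named facts).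
-/

set_option linter.dupNamespace false -- project-wide: `Summit.Langlands.Langlands` is the mandated namespace

noncomputable section

open scoped TensorProduct Classical Matrix ComplexConjugate
open MeasureTheory NumberField NumberField.mixedEmbedding Literature.NumberTheory.Automorphic

namespace Summit.Langlands.Langlands.Theorems.HeckeEigenvalueField.Res

/-- **Stub END-PAIR — the Hermitian pairing of the adjoint argument and the adjunction along `𝔭₀`.**
For a clean cuspidal `π` with a unitary twist `T` and an automorphic measure, the tree's positive Hermitian
form `⟨ , ⟩ = carrierForm π λ (pet)` on `W ⊗ E_λ` (Petersson ⊗ admissible; conjugate-linear in the FIRST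
slot), read with its slots flipped (`ip u v := ⟨v, u⟩`, linear in `u`), satisfies the axioms of
`stub_mem_range_of_pairedPrimitive(_two)`, and along the orthonormal basis `xD` of `𝔭₀` (trace-zero
hermitian, where the Petersson product is skew: `pet_lieDerivW_left`, `ResGLnCartan.mixedTrace_trace_x`)
the adjoint of the Leibniz action `X·(w ⊗ e) = Xw ⊗ e + w ⊗ dE(X)e` is `-(π(X) ⊗ 1 - 1 ⊗ dE(X))`
(`carrierForm_lie_left`). [cite: BorelWallach2000, II §2.2 (4)–(5) and §2.5] [cite: Borel1997, 11.12 (2)] -/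
theorem stub_end_pairing {n : ℕ} {K : Type} [Field K] [NumberField K] [NeZero n]
    (hcpt : isCompact_glFiniteIntegralLevel n K) (π : CuspidalAutomorphicRepData n K hcpt)
    (S : Finset {w : InfinitePlace K // w.IsReal}) (lam : (K →+* ℂ) → Fin n → ℤ)
    (T : π.1.UnitaryTwist) (μA : Measure (AdelicGroupData.gl n K).automorphicQuotient)
    [(AdelicGroupData.gl n K).IsAutomorphicMeasure μA] :
    (∀ u v w : π.1.W ⊗[ℂ] ResGLnCohomology.CoeffModule ℂ n K lam,
        ConeDictionary.carrierForm π.1 lam (T.pet μA) w (u + v) =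
          ConeDictionary.carrierForm π.1 lam (T.pet μA) w u + ConeDictionary.carrierForm π.1 lam (T.pet μA) w v) ∧
    (∀ (z : ℂ) (u w : π.1.W ⊗[ℂ] ResGLnCohomology.CoeffModule ℂ n K lam),
        ConeDictionary.carrierForm π.1 lam (T.pet μA) w (z • u) = z * ConeDictionary.carrierForm π.1 lam (T.pet μA) w u) ∧
    (∀ v w : π.1.W ⊗[ℂ] ResGLnCohomology.CoeffModule ℂ n K lam,
        ConeDictionary.carrierForm π.1 lam (T.pet μA) w v =
          (starRingEnd ℂ) (ConeDictionary.carrierForm π.1 lam (T.pet μA) v w)) ∧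
    (∀ v : π.1.W ⊗[ℂ] ResGLnCohomology.CoeffModule ℂ n K lam, v ≠ 0 →
        0 < (ConeDictionary.carrierForm π.1 lam (T.pet μA) v v).re) ∧
    ∀ (i : Fin (ResGLnCartan.pZeroDim n K)) (u v : π.1.W ⊗[ℂ] ResGLnCohomology.CoeffModule ℂ n K lam),
      ConeDictionary.carrierForm π.1 lam (T.pet μA) v
          (GKTensor.lie (AutomorphyDatum.gl n K hcpt).arch π.1.lieRepW (ConeDictionary.σ𝔤S hcpt lam)
            (ConeDictionary.xD n K hcpt i) u) =
        ConeDictionary.carrierForm π.1 lam (T.pet μA)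
          (-((π.1.lieRepW (ConeDictionary.xD n K hcpt i)).rTensor (ResGLnCohomology.CoeffModule ℂ n K lam) v -
              (ConeDictionary.σ𝔤S hcpt lam (ConeDictionary.xD n K hcpt i)).lTensor π.1.W v)) u := by
  -- `S` (the set of real places of the line's complex) plays no role in this statement
  have _keep := S
  -- the Petersson product is positive definite Hermitian, hence so is `⟨ , ⟩_W ⊗ adm`
  have hip : Kuga.IsPosForm (T.pet μA) := T.isPosForm_pet μA
  have hcf : Kuga.IsPosForm (ConeDictionary.carrierForm π.1 lam (T.pet μA)) :=
    ConeDictionary.isPosForm_carrierForm π.1 lam hip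
  -- the `xD i` have norm exponent zero: the Petersson product is skew along them
  have hskew : ∀ (i : Fin (ResGLnCartan.pZeroDim n K)) (w w' : π.1.W),
      T.pet μA (π.1.lieDerivW (ConeDictionary.xD n K hcpt i) w) w' =
        -T.pet μA w (π.1.lieDerivW (ConeDictionary.xD n K hcpt i) w') :=
    fun i w w' => T.pet_lieDerivW_left μA (ConeDictionary.xD n K hcpt i) (ResGLnCartan.mixedTrace_trace_x n K i) w w'
  refine ⟨fun u v w => hcf.add_right w u v, fun z u w => hcf.smul_right z w u,
    fun v w => (hcf.conj_symm w v).symm, fun v hv => ?_, fun i u v => ?_⟩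
  · exact lt_of_le_of_ne (hcf.nonneg v) fun h => hv (hcf.eq_zero_of_re_self_eq_zero h.symm)
  · have h1 := ConeDictionary.carrierForm_lie_left π.1 lam hip (ConeDictionary.xD n K hcpt i)
      (ConeDictionary.conjTranspose_xD n K hcpt i) (hskew i) u v
    rw [← hcf.conj_symm, h1, map_neg, hcf.conj_symm, hcf.neg_left]
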